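import Mathlib
import Summits.NavierStokesRegularity.NavierStokesRegularity.Theorems.FilamentSkeletonRssDefectColumnGateDefsRacc
import Summits.NavierStokesRegularity.NavierStokesRegularity.Theorems.FilamentSkeletonRssDefectColumnGateAccretionBoxMiranda
import Summits.NavierStokesRegularity.NavierStokesRegularity.Theorems.FilamentSkeletonRssKelvinGateSmoothing
import Summits.NavierStokesRegularity.NavierStokesRegularity.Theorems.FilamentSkeletonRssCoreGluingSplit

/-!
# Route `FilamentSkeletonRss` · «A1R-acc» (director-ns dss_120/122 KEEP-R4 branch; items NOT yet filed) — the route-level GLUE, proved on the cut forms: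
# `BoxSkeletonR → CutFormAcc → RssProfileExists`

Helper file (theorems only), `--supports stmt-NavierStokesRegularity-23611 --as helper`; LEAD of 23611, lane ns-filament-21221-p1 g13.  `BoxSkeletonR` and `CutFormAcc`
(`…DefectColumnGateDefsRacc`) are the cut forms of tenure g26's draft items `SkeletonBoxR` (∃-side: continuous core-area box of clause-13-R skeleta with area-face
margins `κ`) and `TransverseReduction1ARacc` (∀-side: reduction modulo the rate mode and the `N` accretion modes with the exported affine area law; LEAD R7: `C²/C¹`
per `(p, β)`), so that on filing day the support item `Selection1ARacc : SkeletonBoxR → TransverseReduction1ARacc → RssProfileExists` is the two `Iff.rfl` transports of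
THIS theorem.  Proof (tenure DESIGN §3, pattern of `boxSelectionRJ_proof` p555397): instantiate the box at `Γ = max (max Γ₁ Γ₂) (|Ce|/(k₀κ) + 1)`; the derived symbols
`u, v, A, T, D` are the explicit formulas; read `(g, B, k)` from the ∀-side; `accretionBox_selection` (p678153: export law + κ-margins + rate faces + joint continuity ⇒
Poincaré–Miranda zero `(p⋆, β⋆)`); at the zero the equation is EXACT, the landed smoothing ladder (`KelvinGate.Smoothing`, `F = 0`) upgrades `C²/C¹` to `C^∞`, and
`stub_rssProfileExists_of_profile` packages the profile.  HONEST FRAMING: glue between two NOT-YET-FILED cruxes of a MODEL route (negative side); both hypotheses are open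
(indeed unfiled) statements about a HYPOTHETICAL blow-up skeleton; nothing here bears on Navier–Stokes regularity or blow-up.
-/

set_option linter.dupNamespace false

noncomputable section

namespace Summit.NavierStokesRegularity.NavierStokesRegularity.Theorems.DefectColumnGate

open Set Function Filter MeasureTheory Real
open Literature.Analysis.FluidPDE Literature.Analysis.FluidPDE.PineauVicol2026
open Summit.NavierStokesRegularity.NavierStokesRegularity.Theses.FilamentSkeletonRss
open scoped InnerProductSpace Laplacian ContDiff Topology BigOperators

/-- **Glue of «A1R-acc» on the cut forms, PROVED**: `BoxSkeletonR → CutFormAcc → RssProfileExists`. -/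
theorem rssProfileExists_of_boxSkeletonR_cutFormAcc (hbox : BoxSkeletonR) (hred : CutFormAcc) : RssProfileExists := by
  classical
  obtain ⟨N, δ, ρ, K, Λ, a, b, cnd, η, Rw, Rb, cg, θ₀, KA, κ, Γ₂, hN, hδ, hρ, ha, _hcnd, hη, hRw, hRb, hcg, hθ₀, hκ, hbox⟩ := hbox
  obtain ⟨k₀, Ce, Γ₁, hk₀, hred⟩ := hred N δ ρ K Λ a b cnd η Rw Rb cg θ₀ KA hN hδ hρ ha hη hRw hRb hcg hθ₀
  set Γ : ℝ := max (max Γ₁ Γ₂) (|Ce| / (k₀ * κ) + 1) with hΓdef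
  have hΓ1 : Γ₁ ≤ Γ := (le_max_left _ _).trans (le_max_left _ _)
  have hΓ2 : Γ₂ ≤ Γ := (le_max_right _ _).trans (le_max_left _ _)
  have hΓ3 : |Ce| / (k₀ * κ) + 1 ≤ Γ := le_max_right _ _
  have hΓpos : 0 < Γ := lt_of_lt_of_le (by positivity) hΓ3
  have hCe : Ce < k₀ * κ * Γ := exportLaw_threshold hk₀ hκ hΓ3
  obtain ⟨γ, α, X, w, c, m, n, Aa, hfam⟩ := hbox Γ hΓ2
  -- the derived symbols of the box at circulation `Γ`
  set u : (Fin N → ℝ) → (Fin N → ℝ → EuclideanSpace ℝ (Fin 3)) → EuclideanSpace ℝ (Fin 3) → EuclideanSpace ℝ (Fin 3) :=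
    fun p Z y => ∑ k : Fin N, (Γ * γ p k / (4 * π)) • ∫ σ : ℝ,
      ((‖y - Z k σ‖ ^ 2 + Real.exp (-(1 + Real.eulerMascheroniConstant - Real.log 2)) * Aa p k σ) ^ (3 / 2 : ℝ))⁻¹ • cross (deriv (Z k) σ) (y - Z k σ)
  set v : (Fin N → ℝ) → EuclideanSpace ℝ (Fin 3) → EuclideanSpace ℝ (Fin 3) :=
    fun p y => u p (X p) y + (1 / 2 : ℝ) • y - α p • cross (EuclideanSpace.single (2 : Fin 3) (1 : ℝ)) y
  set A : (Fin N → ℝ) → Fin N → (EuclideanSpace ℝ (Fin 3) →L[ℝ] EuclideanSpace ℝ (Fin 3)) := fun p j => fderiv ℝ (v p) (X p j (c p j))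
  set T : (Fin N → ℝ) → (Fin N → ℝ → EuclideanSpace ℝ (Fin 3)) → Fin N → ℝ → EuclideanSpace ℝ (Fin 3) :=
    fun p Z j τ => (u p Z (Z j τ) + (1 / 2 : ℝ) • Z j τ - α p • cross (EuclideanSpace.single (2 : Fin 3) (1 : ℝ)) (Z j τ)) -
      (inner ℝ (u p Z (Z j τ) + (1 / 2 : ℝ) • Z j τ - α p • cross (EuclideanSpace.single (2 : Fin 3) (1 : ℝ)) (Z j τ)) (deriv (Z j) τ) /
        ‖deriv (Z j) τ‖ ^ 2) • deriv (Z j) τ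
  set D : (Fin N → ℝ) → Fin N → EuclideanSpace ℝ (Fin 3) → EuclideanSpace ℝ (Fin 3) :=
    fun p j y => (Real.exp (-(inner ℝ (y - X p j (c p j)) (deriv (X p j) (c p j))) ^ 2) *
      ((1 - Real.exp (-(‖y - X p j (c p j)‖ ^ 2 - inner ℝ (y - X p j (c p j)) (deriv (X p j) (c p j)) ^ 2))) /
        (‖y - X p j (c p j)‖ ^ 2 - inner ℝ (y - X p j (c p j)) (deriv (X p j) (c p j)) ^ 2))) •
      cross (deriv (X p j) (c p j)) (y - X p j (c p j))
  obtain ⟨hcl, hface⟩ := hfam u v A T (fun _ _ _ => rfl) (fun _ _ => rfl) (fun _ _ => rfl) (fun _ _ _ _ => rfl)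
  obtain ⟨C₀, M, αo, g, B, k, Zr, U, P, hcont, hgf, hblock⟩ :=
    hred Γ hΓ1 γ α X w c m n Aa u v A T D (fun _ _ _ => rfl) (fun _ _ => rfl) (fun _ _ => rfl) (fun _ _ _ _ => rfl) (fun _ _ _ => rfl) hcl
  -- Poincaré–Miranda on the (N+1)-box: the multipliers and the rate defect vanish together somewhere
  obtain ⟨ps, βs, hps, hβs, hB0, hg0⟩ := accretionBox_selection N (by norm_num : (-1:ℝ) ≤ 1) hk₀ hκ hΓpos hCe
    (fun p j => areaDefect (deriv (w p j) (c p j)) (Aa p j (c p j))) B k g hcont hface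
    (fun p hp β hβ j => (hblock p β hp hβ).2.2.2.2.2.2.2.2.2 j) hgf
  obtain ⟨hαo, hU0, hU2, hP1, hdiv, heq, hdec, hPM, -, -⟩ := hblock ps βs hps hβs
  -- at the zero the profile equation is exact
  have heq0 : ∀ y : EuclideanSpace ℝ (Fin 3), αo ps βs • (cross (EuclideanSpace.single 2 1) (U ps βs y) -
      fderiv ℝ (U ps βs) y (cross (EuclideanSpace.single 2 1) y)) + (1 / 2 : ℝ) • U ps βs y +
      (1 / 2 : ℝ) • fderiv ℝ (U ps βs) y y - (Laplacian.laplacian (U ps βs)) y + fderiv ℝ (U ps βs) y (U ps βs y) + gradient (P ps βs) y = 0 := by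
    intro y
    rw [heq y, hg0, zero_smul, zero_add]
    exact Finset.sum_eq_zero fun j _ => by rw [hB0 j, zero_smul]
  -- smoothing (landed ladder, `F = 0`) and packaging
  have hF : ContDiff ℝ ∞ (fun _ : EuclideanSpace ℝ (Fin 3) => (0 : EuclideanSpace ℝ (Fin 3))) := contDiff_const
  have hUs : ContDiff ℝ ∞ (U ps βs) := KelvinGate.Smoothing.contDiff_velocity_infty (F := fun _ => 0) hU2 hdiv hP1 hF heq0
  have hPs : ContDiff ℝ ∞ (P ps βs) := KelvinGate.Smoothing.contDiff_pressure_infty (F := fun _ => 0) hU2 hdiv hP1 hF heq0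
  have heq0' : ∀ y : EuclideanSpace ℝ (Fin 3), αo ps βs • (rotGen (U ps βs y) - fderiv ℝ (U ps βs) y (rotGen y)) +
      (1 / 2 : ℝ) • U ps βs y + (1 / 2 : ℝ) • fderiv ℝ (U ps βs) y y - (Δ (U ps βs)) y + fderiv ℝ (U ps βs) y (U ps βs y) + gradient (P ps βs) y = 0 := by
    intro y
    simp only [splitGlue_rotGen_eq_cross_single_two]
    exact heq0 y
  exact stub_rssProfileExists_of_profile ⟨αo ps βs, C₀, M, U ps βs, P ps βs, hαo, hU0, hUs, hPs, hdiv, heq0', hdec, hPM⟩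

end Summit.NavierStokesRegularity.NavierStokesRegularity.Theorems.DefectColumnGate

end
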